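import Literature.MathematicalPhysics.QuantumFieldTheory.Balaban1983to89.B7LocalityGeneral
import Literature.MathematicalPhysics.QuantumFieldTheory.Balaban1983to89.B12Ineq418DeltaB
import Literature.MathematicalPhysics.QuantumFieldTheory.Balaban1983to89.B7Prop6GeneralAnalytic

/-!
# `Balaban1983to89.B12Ineq417Regular` — [Balaban1987RG1] (4.17) p. 285, and «The inequalities (4.17), (4.18) hold for the field δB also» ((4.17) half), AT A GENERAL
(52)-REGULAR BACKGROUND `U₀`: the Proposition-4-[7] inputs (analyticity and size of `Q_j(U₀, ·)` on the sup-norm polydisc) DISCHARGED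
from the printed regularity of `U₀`; the only displayed input left is the background-variation bound

HONEST FRAMING (cell `lit-balaban`, verbatim): statement-level skeleton of published theorems with citation tags; proofs where
landed; nothing here is a claim about the Yang–Mills mass gap.

CITATION HEADER.  T. Bałaban, *Renormalization group approach to lattice gauge field theories. I*, Commun. Math. Phys. **109** (1987)
249–301 [Balaban1987RG1] (cell paper B12; journal page = PDF page + 248), (4.16)–(4.17) p. 285: «The field A is regular on η-lattice, it
satisfies the bounds (3.32), hence the derivative ∂^ξA_λ can be bounded by O(1)L^jη. The same remark applies to the derivative ∂^ξζ̃_□.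
More precisely, (3.32) and Proposition 5 [7] on functional derivatives of averaging operations imply
|(∂_νB_μ)(x)| < O(1)(α₂ + B₃O(1)Mα₀)(L^jη)² < α₁(L^jη)². (4.17)», «The inequalities (4.17), (4.18) hold for the field δB also.»;
T. Bałaban, *Averaging operations for lattice gauge theories*, Commun. Math. Phys. **98** (1985) 17–51 [Balaban1985Averaging] (cell
paper B7; journal page = PDF page + 16): Proposition 2 with (52) p. 26 («|U₀(∂p) − 1| < α₀η²»), p. 37 after (127) («We assume that U₀
satisfies the assumptions of Proposition 2 and U₁ = e^{iηA}, |A| < α₁»), Proposition 4 p. 38 with (131) («|Q_j(U₀, ηA)| < 2α₁L^jη») and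
its analyticity clause (p. 36, «Q(V₀, A, c) is an analytic function of A»).  Unit `lit-balaban-r20` gen 5 (fold owner of B12);
SUPPLEMENT to row B12.Eq4.16-4.18 (owner cell r09 `typed p243650`; r20 supplements `B12Ineq417Flat` p246801, `B12Ineq418Flat` p247232,
`B7TranslationCovariance` p247411, `B12Ineq417General` p247730, `B12Ineq417DeltaB` p248023, `B12Ineq418DeltaB` p248455,
`B7LocalityGeneral` p248672) and the COMPLETION of the NE9 owner's NEED-3 (a) (HOME/INBOX 2026-08-21T03:5xZ: «(4.17) [I] p. 285 at a
GENERAL (2)-regular small background U₀ on the concrete ℤ^d carrier»).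

READING NOTE (r20, located).  In print (4.16)–(4.18) are stated for `B_μ(x) = ζ̃_□(x)Q_{j,μ}(ηA, x)` with the TRANSLATION-INVARIANT
`Q_j` of the flat background `U_j(□₀, 1)` of (4.19) — proved hypothesis-free in `B12Ineq417Flat`/`B12Ineq417General.ineq417_flat_cauchy`.
At a general background `U₀` the covariant composite `Q_j(U₀, ·)` of [7] (127) (`B7Prop4GeneralLevels.logCovIter`) is only translation
COVARIANT (`B7TranslationCovariance.logCovIter_shiftCfg`), and (4.16) acquires a third, BACKGROUND-variation term
`ζ̃(x)[Q_{j,μ}(t_{L^je_ν}U₀, B)(x) − Q_{j,μ}(U₀, B)(x)]` (`B7TranslationCovariance.eq416_general_split`).  That term is not the subject of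
any proposition of [7] (it is a derivative of the background, controlled in [I] through the regularity of the minimizers of [15]); it
vanishes at every `t_{L^je_ν}`-invariant background, in particular at the print's `U₀ = 1`.  It stays a displayed hypothesis `ε_bg` here.

THE POINT.  `B7LocalityGeneral.ineq417_general_local` / `ineq417_deltaB_general_local` (gen 4) left, besides `ε_bg`, two inputs at a
general background: the analyticity and the size of `q ↦ Q_{j,μ}(tU₀, ins q)(z)` on the sup-norm ball of `𝔸^S`, `S = B^j(c₋) ∪ B^j(c₊)`
(Proposition 4 of [7] at the translated background `tU₀`, `t = t_{L^je_ν}`).  Both are now Literature theorems at every (52)-regular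
`G`-valued background — r04's `B7Prop6GeneralAnalytic.prop4_general_analyticAt` (analyticity of every composite (127) in any bondwise
analytic parametrisation) and p06's `B7Eq123General.prop4_general` ((131) `‖Q_j(U₀, ηB)‖ ≤ 2L^jb`, k-uniform, unconditional) —, and
(52)-regularity is translation invariant (`pdev_shiftCfg`, this file).  Hence (4.17) and δB-(4.17) at a general (52)-regular background
with the SAME constants as the flat Cauchy route (`M = 2L^jb₁`, `M₀ = 2L^jb`): `ineq417_regular`, `ineq417_deltaB_regular`; at a
`t_{L^je_ν}`-invariant background `ε_bg = 0` (`ineq417_regular_of_invariant`).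

HYPOTHESES ON `U₀` (verbatim the ones of `B7Eq123General.prop4_general`, p. 37 «U₀ satisfies the assumptions of Proposition 2»):
`L ≥ 2`; `U₀` with values in an averaging-closed subgroup `G` (`B7Prop2Explicit.AvgClosed`); (52) `pdev U₀ < α₀·L^{−2k}`; `C₀(d)α₀ ≤ ⅓`;
`4α₀ ≤ c₂′(d, L)`; the level `j ≤ k`; the Prop.-4 smallness at the polydisc radius `b₁`: `e^{4cα₀}(1 + 8C₁L^kb₁) ≤ 2`
(`c = 800(d+1)²(d+4)`, `C₁ = 131072(d+1)²`) and `2L^kb₁ ≤ c₃(d, L)` («α₁ ≦ ½c₃»).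

WHAT THIS FILE PROVES (kernel, 0 sorry, standard axioms; theorems only — no definition, no `def … : Prop`):
* §1 `pdev_shiftCfg` — the plaquette deviation (52) is translation invariant; `mem_shiftCfg` — so is `G`-valuedness.
* §2 `smallness_mono` — the two Prop.-4 smallness conditions are monotone in the radius.
* §3 `analyticOnNhd_logCovIter_ins`, `norm_logCovIter_ins_le` — Prop. 4 of [7] at the translated background `t_aU₀` on the sup-norm
  ball of `𝔸^S` (r04's and p06's theorems transported by §1–§2): the two displayed inputs of gen 4, as theorems.
* §4 **`ineq417_regular`** — (4.17) at a general (52)-regular background: `‖(∂_νB_μ)(x)‖ ≤ δ·2L^jb + |ζ̃(x)|·(2L^jb₁·L^jg/ρ + ε_bg)`;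
  `ineq417_regular_of_invariant` (`ε_bg = 0` at a `t_{L^je_ν}`-invariant background).
* §5 **`ineq417_deltaB_regular`** — «for δB also»: `‖δB_μ(x+e_ν) − δB_μ(x)‖ ≤ 2L^jb₁·(L^jg_W/ρ + ω·L^jg/ρ²) + ε_bg`;
  `ineq417_deltaB_regular_of_invariant`.
* §6 (v1.1) **`ineq418_deltaB_regular_of_invariant`** — the (4.18) half of «(4.17), (4.18) hold for the field δB also» at a
  `t_λ`-, `t_ν`-invariant (52)-regular background: `B12Ineq418DeltaB.ineq418_deltaB_invariant` with its chart / analyticity / size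
  inputs DISCHARGED (`B7LocalityGeneral.logCovIter_eq_chart` + §3 at `a = 0`), `M = 2L^jb₁`.

DIVERGENCES / NOT PROVED.  `ℤ^d`, no torus (descent: `B7AvgPeriodicity`); constants OURS (the print's `O(1)(α₂ + B₃O(1)Mα₀)(L^jη)²` is
recovered with the dictionary of `B12Ineq417Flat`: `b, b₁ = O(η)`, `g = O(η²)`, `δ = O(L^jη)`, `ρ = b₁/4`); the background-variation
bound `ε_bg` is a HYPOTHESIS (not a [7] proposition; zero at invariant backgrounds); (4.18) for `B` itself at a general background is
not treated here (flat: `B12Ineq418Flat`); (4.18) for `δB` only at translation-invariant backgrounds (§6; displayed-input form: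
`B12Ineq418DeltaB`).
DOCFIX (r20 g20, 2026-08-22): title quotation corrected to the print — QF57-004 (summit-lit1 g57 `qfid_slips_g57.tsv`, confirmed r09 g19 / r20 g20 on `paper:balaban1987-cmp109-rg-i-small-field` p0037 L21–22: «The inequalities (4.17), (4.18) hold for the field δB also.»); header-only, declarations byte-identical.
-/

noncomputable section

open scoped BigOperators
open Set Metric
open Literature.MathematicalPhysics.QuantumFieldTheory.Balaban1983to89
open Literature.MathematicalPhysics.QuantumFieldTheory.Balaban1983to89.B7Prop1Explicit (e hol plaqWord)
open Literature.MathematicalPhysics.QuantumFieldTheory.Balaban1983to89.B7Prop2Explicit (pdev AvgClosed C0 c2')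
open Literature.MathematicalPhysics.QuantumFieldTheory.Balaban1983to89.B7Prop3Flat (insCfg c3 norm_insCfg_le analyticAt_insCfg)
open Literature.MathematicalPhysics.QuantumFieldTheory.Balaban1983to89.B7Prop4GeneralLevels (logCovIter)
open Literature.MathematicalPhysics.QuantumFieldTheory.Balaban1983to89.B12Ineq417Flat (shiftCfg shiftCfg_apply hol_shiftCfg boxBonds)
open Literature.MathematicalPhysics.QuantumFieldTheory.Balaban1983to89.B7TranslationCovariance (dlocBG)
open Literature.MathematicalPhysics.QuantumFieldTheory.Balaban1983to89.B12Ineq417DeltaB (dQ dQ_shiftCfg)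
open Literature.MathematicalPhysics.QuantumFieldTheory.Balaban1983to89.B7LocalityGeneral (ineq417_general_local
  ineq417_deltaB_general_local)
open Literature.MathematicalPhysics.QuantumFieldTheory.Balaban1983to89.B7Prop6GeneralAnalytic (prop4_general_analyticAt)
open Literature.MathematicalPhysics.QuantumFieldTheory.Balaban1983to89.B7Eq123General (prop4_general)

namespace Literature.MathematicalPhysics.QuantumFieldTheory.Balaban1983to89.B12Ineq417Regular

variable {d : ℕ}

/-! ## §1 (52)-regularity and `G`-valuedness are translation invariant -/

section Shift

variable {𝔸 : Type*} [NormedRing 𝔸] [NormedAlgebra ℂ 𝔸] [CompleteSpace 𝔸]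

omit [NormedAlgebra ℂ 𝔸] [CompleteSpace 𝔸] in
/-- **The plaquette deviation (52) is translation invariant**: `sup_p |(t_aU₀)(∂p) − 1| = sup_p |U₀(∂p) − 1|` — the plaquettes of
`t_aU₀` are the translated plaquettes of `U₀` (`B12Ineq417Flat.hol_shiftCfg`), and translation permutes the index set of the
supremum. [cite: Balaban1985Averaging, (52) p.26, (44) p.24] (elementary; our proof) -/
theorem pdev_shiftCfg (a : B7Prop1Explicit.Site d) (V : B7Prop1Explicit.Site d → Fin d → 𝔸ˣ) :
    pdev (shiftCfg a V) = pdev V := by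
  unfold pdev
  simp only [hol_shiftCfg]
  change sSup (Set.range _) = sSup (Set.range _)
  congr 1
  ext r
  constructor
  · rintro ⟨p, rfl⟩
    exact ⟨(p.1 + a, p.2), rfl⟩
  · rintro ⟨p, rfl⟩
    refine ⟨(p.1 - a, p.2), ?_⟩
    simp only [sub_add_cancel]

omit [NormedAlgebra ℂ 𝔸] [CompleteSpace 𝔸] in
/-- `G`-valuedness is translation invariant. [cite: Balaban1985Averaging, p.37 (after (127))] (elementary; our proof) -/
theorem mem_shiftCfg {G : Subgroup 𝔸ˣ} (a : B7Prop1Explicit.Site d) {V : B7Prop1Explicit.Site d → Fin d → 𝔸ˣ}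
    (hV : ∀ x κ, V x κ ∈ G) : ∀ x κ, shiftCfg a V x κ ∈ G :=
  fun x κ => by rw [shiftCfg_apply]; exact hV _ _

end Shift

/-! ## §2 Monotonicity of the Proposition-4 smallness conditions in the radius -/

/-- The two smallness conditions of Proposition 4 of [7] («e^{O(1)2α₀}(1 + 8C₁α₁)α₁ < 2α₁», «α₁ ≦ ½c₃») are monotone in the radius:
they pass from the polydisc radius `b₁` to any `b ≤ b₁`. [cite: Balaban1985Averaging, Prop. 4 p.38, p.37 (after (129))]
(elementary; our proof — the same remark as r04's private `B7Prop6GeneralAnalytic.smallness_mono`) -/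
theorem smallness_mono {L k : ℕ} {α₀ b b₁ : ℝ} (hbb₁ : b ≤ b₁)
    (hsmall : Real.exp (4 * (800 * ((d : ℝ) + 1) ^ 2 * ((d : ℝ) + 4)) * α₀)
      * (1 + 8 * (131072 * ((d : ℝ) + 1) ^ 2) * ((L : ℝ) ^ k * b₁)) ≤ 2)
    (hc₃ : 2 * ((L : ℝ) ^ k * b₁) ≤ c3 d L) :
    Real.exp (4 * (800 * ((d : ℝ) + 1) ^ 2 * ((d : ℝ) + 4)) * α₀)
        * (1 + 8 * (131072 * ((d : ℝ) + 1) ^ 2) * ((L : ℝ) ^ k * b)) ≤ 2 ∧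
      2 * ((L : ℝ) ^ k * b) ≤ c3 d L := by
  have hLk : (0 : ℝ) ≤ (L : ℝ) ^ k := by positivity
  have hm : (L : ℝ) ^ k * b ≤ (L : ℝ) ^ k * b₁ := mul_le_mul_of_nonneg_left hbb₁ hLk
  refine ⟨?_, by linarith⟩
  have hexp : 0 ≤ Real.exp (4 * (800 * ((d : ℝ) + 1) ^ 2 * ((d : ℝ) + 4)) * α₀) := (Real.exp_pos _).le
  have h1 : 1 + 8 * (131072 * ((d : ℝ) + 1) ^ 2) * ((L : ℝ) ^ k * b)
      ≤ 1 + 8 * (131072 * ((d : ℝ) + 1) ^ 2) * ((L : ℝ) ^ k * b₁) := by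
    have : 0 ≤ 8 * (131072 * ((d : ℝ) + 1) ^ 2) := by positivity
    nlinarith
  exact (mul_le_mul_of_nonneg_left h1 hexp).trans hsmall

/-! ## §3 Proposition 4 of [7] at the translated background on the sup-norm ball of `𝔸^S` -/

section Prop4

variable {𝔸 : Type*} [NormedRing 𝔸] [NormedAlgebra ℂ 𝔸] [CompleteSpace 𝔸] [NormOneClass 𝔸]

/-- **ANALYTICITY INPUT, DISCHARGED**: at a (52)-regular `G`-valued background `U₀` (hypotheses of `B7Eq123General.prop4_general`, with
the smallness at the radius `b₁`), for every translation `a`, every finite bond set `S`, every level `j ≤ k` and every `L^j`-bond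
`⟨z, z + e_μ⟩`, the map `q ↦ Q_{j,μ}(t_aU₀, ins q)(z)` is analytic on a neighbourhood of every point of the open sup-norm ball of radius
`b₁` in `𝔸^S` — r04's `B7Prop6GeneralAnalytic.prop4_general_analyticAt` in the bondwise-analytic parametrisation `q ↦ ins q`
(`B7Prop3Flat.analyticAt_insCfg`) at the translated background (§1). [cite: Balaban1985Averaging, Prop. 4 p.38, p.36 (after (121)), (52) p.26] -/
theorem analyticOnNhd_logCovIter_ins (S : Finset (B7Prop1Explicit.Site d × Fin d)) (L : ℕ) (hL : 2 ≤ L) {G : Subgroup 𝔸ˣ}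
    (hG : AvgClosed d L G) (k : ℕ) (U₀ : B7Prop1Explicit.Site d → Fin d → 𝔸ˣ) (hU₀ : ∀ x κ, U₀ x κ ∈ G) {α₀ : ℝ}
    (hα : 0 < α₀) (hα3 : C0 d * α₀ ≤ 1 / 3) (hα4 : 4 * α₀ ≤ c2' d L) (h52 : pdev U₀ < α₀ * (((L : ℝ) ^ k)⁻¹) ^ 2)
    {b₁ : ℝ}
    (hsmall : Real.exp (4 * (800 * ((d : ℝ) + 1) ^ 2 * ((d : ℝ) + 4)) * α₀)
      * (1 + 8 * (131072 * ((d : ℝ) + 1) ^ 2) * ((L : ℝ) ^ k * b₁)) ≤ 2)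
    (hc₃ : 2 * ((L : ℝ) ^ k * b₁) ≤ c3 d L) (a : B7Prop1Explicit.Site d) {j : ℕ} (hj : j ≤ k)
    (z : B7Prop1Explicit.Site d) (μ : Fin d) :
    AnalyticOnNhd ℂ (fun q : S → 𝔸 => logCovIter L (shiftCfg a U₀) (insCfg S q) j z μ) (ball 0 b₁) := by
  intro q hq
  have hqn : ‖q‖ < b₁ := mem_ball_zero_iff.1 hq
  obtain ⟨hs, hc⟩ := smallness_mono (d := d) (L := L) (k := k) (α₀ := α₀) hqn.le hsmall hc₃
  have h52' : pdev (shiftCfg a U₀) < α₀ * (((L : ℝ) ^ k)⁻¹) ^ 2 := by rw [pdev_shiftCfg]; exact h52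
  exact prop4_general_analyticAt L hL hG k (shiftCfg a U₀) (mem_shiftCfg a hU₀) hα hα3 hα4 h52'
    (fun q' : S → 𝔸 => insCfg S q') (fun x κ => analyticAt_insCfg S x κ q) (norm_nonneg q)
    (fun x κ => norm_insCfg_le S q x κ) hs hc j hj z μ

/-- **SIZE INPUT (131), DISCHARGED**: under the same hypotheses, `‖Q_{j,μ}(t_aU₀, ins q)(z)‖ ≤ 2L^jb₁` on the open sup-norm ball of
radius `b₁` — p06's `B7Eq123General.prop4_general` ((131) «|Q_j(U₀, ηA)| < 2α₁L^jη», k-uniform) at the translated background, for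
the field `ins q` of sup norm `≤ ‖q‖ < b₁`. [cite: Balaban1985Averaging, (131) p.38, (52) p.26] -/
theorem norm_logCovIter_ins_le (S : Finset (B7Prop1Explicit.Site d × Fin d)) (L : ℕ) (hL : 2 ≤ L) {G : Subgroup 𝔸ˣ}
    (hG : AvgClosed d L G) (k : ℕ) (U₀ : B7Prop1Explicit.Site d → Fin d → 𝔸ˣ) (hU₀ : ∀ x κ, U₀ x κ ∈ G) {α₀ : ℝ}
    (hα : 0 < α₀) (hα3 : C0 d * α₀ ≤ 1 / 3) (hα4 : 4 * α₀ ≤ c2' d L) (h52 : pdev U₀ < α₀ * (((L : ℝ) ^ k)⁻¹) ^ 2)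
    {b₁ : ℝ} (hb₁ : 0 ≤ b₁)
    (hsmall : Real.exp (4 * (800 * ((d : ℝ) + 1) ^ 2 * ((d : ℝ) + 4)) * α₀)
      * (1 + 8 * (131072 * ((d : ℝ) + 1) ^ 2) * ((L : ℝ) ^ k * b₁)) ≤ 2)
    (hc₃ : 2 * ((L : ℝ) ^ k * b₁) ≤ c3 d L) (a : B7Prop1Explicit.Site d) {j : ℕ} (hj : j ≤ k)
    (z : B7Prop1Explicit.Site d) (μ : Fin d) :
    ∀ q ∈ ball (0 : S → 𝔸) b₁, ‖logCovIter L (shiftCfg a U₀) (insCfg S q) j z μ‖ ≤ 2 * ((L : ℝ) ^ j * b₁) := by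
  intro q hq
  have hqn : ‖q‖ < b₁ := mem_ball_zero_iff.1 hq
  have h52' : pdev (shiftCfg a U₀) < α₀ * (((L : ℝ) ^ k)⁻¹) ^ 2 := by rw [pdev_shiftCfg]; exact h52
  have hins : ∀ x κ, ‖insCfg S q x κ‖ ≤ b₁ := fun x κ => (norm_insCfg_le S q x κ).trans hqn.le
  exact (prop4_general L hL hG k (shiftCfg a U₀) (mem_shiftCfg a hU₀) hα hα3 hα4 h52' (insCfg S q) hb₁ hins
    hsmall hc₃ j hj).2 z μ

/-! ## §4 (4.17) at a general (52)-regular background -/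

/-- **(4.17) AT A GENERAL (52)-REGULAR BACKGROUND.**  Data: `L ≥ 2`; `U₀` `G`-valued (`AvgClosed`) with `pdev U₀ < α₀L^{−2k}`,
`C₀α₀ ≤ ⅓`, `4α₀ ≤ c₂′(d, L)` («U₀ satisfies the assumptions of Proposition 2», [7] p. 37); a level `j ≤ k`; the field `B` («ηA»)
with `sup ‖B‖ ≤ b` and fine `ν`-differences `≤ g` («the derivative ∂^ξA_λ can be bounded by O(1)L^jη», from (3.32)); the cut-off `ζ̃`
with `|ζ̃(x + e_ν) − ζ̃(x)| ≤ δ`; a polydisc radius `b₁` with the Prop.-4 smallness `e^{4cα₀}(1 + 8C₁L^kb₁) ≤ 2`, `2L^kb₁ ≤ c₃(d, L)` and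
a margin `b + L^jg + ρ ≤ b₁`, `ρ > 0`; and the background-variation bound
`‖Q_{j,μ}(t_{L^je_ν}U₀, B)(x) − Q_{j,μ}(U₀, B)(x)‖ ≤ ε_bg`.  CONCLUSION:
`‖(∂_νB_μ)(x)‖ ≤ δ·2L^jb + |ζ̃(x)|·(2L^jb₁·L^jg/ρ + ε_bg)` — `B7LocalityGeneral.ineq417_general_local` with its analyticity and size
inputs supplied by §3 (`M = 2L^jb₁`) and `M₀ = 2L^jb` by (131) at `U₀`.  With `b, b₁ = O(η)`, `g = O(η²)`, `δ = O(L^jη)`, `ρ = b₁/4`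
this is the printed `O(1)(…)(L^jη)²` law; at `U₀ = 1` it is `B12Ineq417General.ineq417_flat_cauchy`.
[cite: Balaban1987RG1, (4.17) p.285, (3.32) p.277; Balaban1985Averaging, Prop. 4 (131) p.38, (52) p.26, (127) p.37] -/
theorem ineq417_regular (ζ : B7Prop1Explicit.Site d → ℝ) (L : ℕ) (hL : 2 ≤ L) {G : Subgroup 𝔸ˣ} (hG : AvgClosed d L G)
    (k : ℕ) (U₀ : B7Prop1Explicit.Site d → Fin d → 𝔸ˣ) (hU₀ : ∀ x κ, U₀ x κ ∈ G) {α₀ : ℝ} (hα : 0 < α₀)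
    (hα3 : C0 d * α₀ ≤ 1 / 3) (hα4 : 4 * α₀ ≤ c2' d L) (h52 : pdev U₀ < α₀ * (((L : ℝ) ^ k)⁻¹) ^ 2)
    (B : B7Prop1Explicit.Site d → Fin d → 𝔸) {j : ℕ} (hj : j ≤ k) (ν : Fin d) (z : B7Prop1Explicit.Site d) (μ : Fin d)
    {b b₁ g ρ εbg δ : ℝ} (hb : 0 ≤ b) (hB : ∀ x κ, ‖B x κ‖ ≤ b)
    (hsmall : Real.exp (4 * (800 * ((d : ℝ) + 1) ^ 2 * ((d : ℝ) + 4)) * α₀)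
      * (1 + 8 * (131072 * ((d : ℝ) + 1) ^ 2) * ((L : ℝ) ^ k * b₁)) ≤ 2)
    (hc₃ : 2 * ((L : ℝ) ^ k * b₁) ≤ c3 d L)
    (hg0 : 0 ≤ g) (hg : ∀ x κ, ‖B (x + e ν) κ - B x κ‖ ≤ g) (hρ : 0 < ρ) (hroom : b + (L : ℝ) ^ j * g + ρ ≤ b₁)
    (hbg : ‖logCovIter L (shiftCfg (((L : ℤ) ^ j) • e ν) U₀) B j z μ - logCovIter L U₀ B j z μ‖ ≤ εbg)
    (hζ : |ζ (z + e ν) - ζ z| ≤ δ) :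
    ‖dlocBG ζ L U₀ B j ν z μ‖
      ≤ δ * (2 * ((L : ℝ) ^ j * b)) + |ζ z| * (2 * ((L : ℝ) ^ j * b₁) * ((L : ℝ) ^ j * g) / ρ + εbg) := by
  have hL1 : 1 ≤ L := le_trans (by norm_num) hL
  have hb₁ : b ≤ b₁ := by nlinarith [pow_nonneg (Nat.cast_nonneg L : (0 : ℝ) ≤ L) j]
  have hb₁0 : 0 ≤ b₁ := le_trans hb hb₁
  obtain ⟨hsmall_b, hc₃_b⟩ := smallness_mono (d := d) (L := L) (k := k) (α₀ := α₀) hb₁ hsmall hc₃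
  -- the two Proposition-4 inputs at the translated background, on the sup-norm ball of `𝔸^S`, `S = boxBonds L j z μ`
  have hφ : DifferentiableOn ℂ (fun q : boxBonds L j z μ → 𝔸 =>
      logCovIter L (shiftCfg (((L : ℤ) ^ j) • e ν) U₀) (insCfg (boxBonds L j z μ) q) j z μ) (ball 0 b₁) :=
    (analyticOnNhd_logCovIter_ins (boxBonds L j z μ) L hL hG k U₀ hU₀ hα hα3 hα4 h52 hsmall hc₃
      (((L : ℤ) ^ j) • e ν) hj z μ).differentiableOn
  have hM := norm_logCovIter_ins_le (boxBonds L j z μ) L hL hG k U₀ hU₀ hα hα3 hα4 h52 hb₁0 hsmall hc₃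
    (((L : ℤ) ^ j) • e ν) hj z μ
  -- the size (131) at the background `U₀` itself
  have hQ : ‖logCovIter L U₀ B j (z + e ν) μ‖ ≤ 2 * ((L : ℝ) ^ j * b) :=
    (prop4_general L hL hG k U₀ hU₀ hα hα3 hα4 h52 B hb hB hsmall_b hc₃_b j hj).2 _ _
  exact ineq417_general_local ζ L hL1 U₀ B j ν z μ hφ (by positivity) hM hb hB hg0 hg hρ hroom hQ hbg hζ

/-- **(4.17) at a `t_{L^je_ν}`-INVARIANT (52)-regular background** (`t_{L^je_ν}U₀ = U₀`, e.g. the print's `U₀ = 1` of (4.19), or any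
background periodic under `L^je_ν`): the background-variation term vanishes and
`‖(∂_νB_μ)(x)‖ ≤ δ·2L^jb + |ζ̃(x)|·2L^jb₁·L^jg/ρ`. [cite: Balaban1987RG1, (4.17) p.285, (4.19) p.285; Balaban1985Averaging, Prop. 4 (131) p.38, (52) p.26] -/
theorem ineq417_regular_of_invariant (ζ : B7Prop1Explicit.Site d → ℝ) (L : ℕ) (hL : 2 ≤ L) {G : Subgroup 𝔸ˣ}
    (hG : AvgClosed d L G) (k : ℕ) (U₀ : B7Prop1Explicit.Site d → Fin d → 𝔸ˣ) (hU₀ : ∀ x κ, U₀ x κ ∈ G) {α₀ : ℝ}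
    (hα : 0 < α₀) (hα3 : C0 d * α₀ ≤ 1 / 3) (hα4 : 4 * α₀ ≤ c2' d L) (h52 : pdev U₀ < α₀ * (((L : ℝ) ^ k)⁻¹) ^ 2)
    (B : B7Prop1Explicit.Site d → Fin d → 𝔸) {j : ℕ} (hj : j ≤ k) (ν : Fin d)
    (hinv : shiftCfg (((L : ℤ) ^ j) • e ν) U₀ = U₀) (z : B7Prop1Explicit.Site d) (μ : Fin d)
    {b b₁ g ρ δ : ℝ} (hb : 0 ≤ b) (hB : ∀ x κ, ‖B x κ‖ ≤ b)
    (hsmall : Real.exp (4 * (800 * ((d : ℝ) + 1) ^ 2 * ((d : ℝ) + 4)) * α₀)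
      * (1 + 8 * (131072 * ((d : ℝ) + 1) ^ 2) * ((L : ℝ) ^ k * b₁)) ≤ 2)
    (hc₃ : 2 * ((L : ℝ) ^ k * b₁) ≤ c3 d L)
    (hg0 : 0 ≤ g) (hg : ∀ x κ, ‖B (x + e ν) κ - B x κ‖ ≤ g) (hρ : 0 < ρ) (hroom : b + (L : ℝ) ^ j * g + ρ ≤ b₁)
    (hζ : |ζ (z + e ν) - ζ z| ≤ δ) :
    ‖dlocBG ζ L U₀ B j ν z μ‖
      ≤ δ * (2 * ((L : ℝ) ^ j * b)) + |ζ z| * (2 * ((L : ℝ) ^ j * b₁) * ((L : ℝ) ^ j * g) / ρ) := by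
  have hbg : ‖logCovIter L (shiftCfg (((L : ℤ) ^ j) • e ν) U₀) B j z μ - logCovIter L U₀ B j z μ‖ ≤ 0 := by
    rw [hinv, sub_self, norm_zero]
  have h := ineq417_regular ζ L hL hG k U₀ hU₀ hα hα3 hα4 h52 B hj ν z μ hb hB hsmall hc₃ hg0 hg hρ hroom hbg hζ
  simpa only [add_zero] using h

/-! ## §5 «The inequalities (4.17), (4.18) hold for the field δB also» — the (4.17) half at a general (52)-regular background -/

/-- **(4.17) FOR `δB` AT A GENERAL (52)-REGULAR BACKGROUND.**  `δB_μ(x) = ⟨(δ/δA)Q_{j,μ}(U₀, ·)(F), W⟩(x)` is the object (4.6)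
`B12Ineq417DeltaB.dQ`.  Data: `U₀` as in `ineq417_regular`; `sup ‖F‖ ≤ b`, fine `ν`-differences of `F` `≤ g`; `sup ‖W‖ ≤ ω`, fine
`ν`-differences of `W` `≤ g_W`; the Prop.-4 smallness at the radius `b₁` and a margin `b + L^jg + 2ρ ≤ b₁`; the background-variation
bound `‖δQ(t_{L^je_ν}U₀)(x) − δQ(U₀)(x)‖ ≤ ε_bg`.  CONCLUSION:
`‖δB_μ(x + e_ν) − δB_μ(x)‖ ≤ 2L^jb₁·L^jg_W/ρ + 2L^jb₁·ω·L^jg/ρ² + ε_bg` — `B7LocalityGeneral.ineq417_deltaB_general_local` with its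
analyticity and size inputs supplied by §3. [cite: Balaban1987RG1, (4.17) p.285, (4.6) p.282; Balaban1985Averaging, Prop. 4 (131) p.38, (52) p.26] -/
theorem ineq417_deltaB_regular (L : ℕ) (hL : 2 ≤ L) {G : Subgroup 𝔸ˣ} (hG : AvgClosed d L G)
    (k : ℕ) (U₀ : B7Prop1Explicit.Site d → Fin d → 𝔸ˣ) (hU₀ : ∀ x κ, U₀ x κ ∈ G) {α₀ : ℝ} (hα : 0 < α₀)
    (hα3 : C0 d * α₀ ≤ 1 / 3) (hα4 : 4 * α₀ ≤ c2' d L) (h52 : pdev U₀ < α₀ * (((L : ℝ) ^ k)⁻¹) ^ 2)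
    (F W : B7Prop1Explicit.Site d → Fin d → 𝔸) {j : ℕ} (hj : j ≤ k) (ν : Fin d) (z : B7Prop1Explicit.Site d) (μ : Fin d)
    {b b₁ g gW ω ρ εbg : ℝ} (hb : 0 ≤ b) (hF : ∀ x κ, ‖F x κ‖ ≤ b)
    (hsmall : Real.exp (4 * (800 * ((d : ℝ) + 1) ^ 2 * ((d : ℝ) + 4)) * α₀)
      * (1 + 8 * (131072 * ((d : ℝ) + 1) ^ 2) * ((L : ℝ) ^ k * b₁)) ≤ 2)
    (hc₃ : 2 * ((L : ℝ) ^ k * b₁) ≤ c3 d L)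
    (hg0 : 0 ≤ g) (hg : ∀ x κ, ‖F (x + e ν) κ - F x κ‖ ≤ g)
    (hω : 0 ≤ ω) (hW : ∀ x κ, ‖W x κ‖ ≤ ω) (hgW0 : 0 ≤ gW) (hgW : ∀ x κ, ‖W (x + e ν) κ - W x κ‖ ≤ gW)
    (hρ : 0 < ρ) (hroom : b + (L : ℝ) ^ j * g + 2 * ρ ≤ b₁)
    (hbg : ‖dQ L (shiftCfg (((L : ℤ) ^ j) • e ν) U₀) F W j z μ - dQ L U₀ F W j z μ‖ ≤ εbg) :
    ‖dQ L U₀ F W j (z + e ν) μ - dQ L U₀ F W j z μ‖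
      ≤ 2 * ((L : ℝ) ^ j * b₁) * ((L : ℝ) ^ j * gW) / ρ
        + 2 * ((L : ℝ) ^ j * b₁) * ω * ((L : ℝ) ^ j * g) / ρ ^ 2 + εbg := by
  have hL1 : 1 ≤ L := le_trans (by norm_num) hL
  have hb₁ : b ≤ b₁ := by nlinarith [pow_nonneg (Nat.cast_nonneg L : (0 : ℝ) ≤ L) j]
  have hb₁0 : 0 ≤ b₁ := le_trans hb hb₁
  have hφ := analyticOnNhd_logCovIter_ins (boxBonds L j z μ) L hL hG k U₀ hU₀ hα hα3 hα4 h52 hsmall hc₃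
    (((L : ℤ) ^ j) • e ν) hj z μ
  have hM := norm_logCovIter_ins_le (boxBonds L j z μ) L hL hG k U₀ hU₀ hα hα3 hα4 h52 hb₁0 hsmall hc₃
    (((L : ℤ) ^ j) • e ν) hj z μ
  exact ineq417_deltaB_general_local L hL1 U₀ F W j ν z μ hφ (by positivity) hM hb hF hg0 hg hω hW hgW0 hgW hρ
    hroom hbg

/-- **δB-(4.17) at a `t_{L^je_ν}`-INVARIANT (52)-regular background**: the background-variation term of `δQ` vanishes
(`B12Ineq417DeltaB.dQ` at `tU₀ = U₀`). [cite: Balaban1987RG1, (4.17) p.285, (4.6) p.282, (4.19) p.285; Balaban1985Averaging, Prop. 4 (131) p.38] -/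
theorem ineq417_deltaB_regular_of_invariant (L : ℕ) (hL : 2 ≤ L) {G : Subgroup 𝔸ˣ} (hG : AvgClosed d L G)
    (k : ℕ) (U₀ : B7Prop1Explicit.Site d → Fin d → 𝔸ˣ) (hU₀ : ∀ x κ, U₀ x κ ∈ G) {α₀ : ℝ} (hα : 0 < α₀)
    (hα3 : C0 d * α₀ ≤ 1 / 3) (hα4 : 4 * α₀ ≤ c2' d L) (h52 : pdev U₀ < α₀ * (((L : ℝ) ^ k)⁻¹) ^ 2)
    (F W : B7Prop1Explicit.Site d → Fin d → 𝔸) {j : ℕ} (hj : j ≤ k) (ν : Fin d)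
    (hinv : shiftCfg (((L : ℤ) ^ j) • e ν) U₀ = U₀) (z : B7Prop1Explicit.Site d) (μ : Fin d)
    {b b₁ g gW ω ρ : ℝ} (hb : 0 ≤ b) (hF : ∀ x κ, ‖F x κ‖ ≤ b)
    (hsmall : Real.exp (4 * (800 * ((d : ℝ) + 1) ^ 2 * ((d : ℝ) + 4)) * α₀)
      * (1 + 8 * (131072 * ((d : ℝ) + 1) ^ 2) * ((L : ℝ) ^ k * b₁)) ≤ 2)
    (hc₃ : 2 * ((L : ℝ) ^ k * b₁) ≤ c3 d L)
    (hg0 : 0 ≤ g) (hg : ∀ x κ, ‖F (x + e ν) κ - F x κ‖ ≤ g)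
    (hω : 0 ≤ ω) (hW : ∀ x κ, ‖W x κ‖ ≤ ω) (hgW0 : 0 ≤ gW) (hgW : ∀ x κ, ‖W (x + e ν) κ - W x κ‖ ≤ gW)
    (hρ : 0 < ρ) (hroom : b + (L : ℝ) ^ j * g + 2 * ρ ≤ b₁) :
    ‖dQ L U₀ F W j (z + e ν) μ - dQ L U₀ F W j z μ‖
      ≤ 2 * ((L : ℝ) ^ j * b₁) * ((L : ℝ) ^ j * gW) / ρ
        + 2 * ((L : ℝ) ^ j * b₁) * ω * ((L : ℝ) ^ j * g) / ρ ^ 2 := by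
  have hbg : ‖dQ L (shiftCfg (((L : ℤ) ^ j) • e ν) U₀) F W j z μ - dQ L U₀ F W j z μ‖ ≤ 0 := by
    rw [hinv, sub_self, norm_zero]
  have h := ineq417_deltaB_regular L hL hG k U₀ hU₀ hα hα3 hα4 h52 F W hj ν z μ hb hF hsmall hc₃ hg0 hg hω hW hgW0
    hgW hρ hroom hbg
  simpa only [add_zero] using h

end Prop4

/-! ## §6 (v1.1) «(4.17), (4.18) hold for the field δB also» — the (4.18) half at a translation-invariant (52)-regular background

`B12Ineq418DeltaB.ineq418_deltaB_invariant` (gen 4) is (4.18) for `δB` at a background invariant under `t_λ = t_{L^je_λ}` and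
`t_ν = t_{L^je_ν}`, from three displayed inputs: the chart `Q_{j,μ}(U₀, G)(z) = φ(G|_S)`, the analyticity of `φ` on the sup-norm
ball of radius `b₁`, and its size `M` there.  At a (52)-regular `G`-valued background all three are now theorems: the chart is
`B7LocalityGeneral.logCovIter_eq_chart` (locality, `S = boxBonds L j z μ`), analyticity and size are §3 at the trivial translation
`a = 0`.  Hence (4.18) for `δB` with `M = 2L^jb₁` and no displayed analytic input. -/

section Ineq418

variable {𝔸 : Type*} [NormedRing 𝔸] [NormedAlgebra ℂ 𝔸] [CompleteSpace 𝔸] [NormOneClass 𝔸]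

/-- **(4.18) FOR `δB` AT A `t_λ`-, `t_ν`-INVARIANT (52)-REGULAR BACKGROUND** («|(∂_λ∂_νB_μ)(x)| < α₁(L^jη)^{2+β} … The inequalities
(4.17), (4.18) hold for the field δB also», p. 285).  Data: `U₀` `G`-valued (`AvgClosed`) with `pdev U₀ < α₀L^{−2k}`, `C₀α₀ ≤ ⅓`,
`4α₀ ≤ c₂′(d, L)`, invariant under `t_{L^je_λ}` and `t_{L^je_ν}`; a level `j ≤ k`; the Prop.-4 smallness at the polydisc radius `b₁`;
`sup ‖F‖ ≤ b`, fine `λ`/`ν`-differences of `F` `≤ g_λ, g_ν`, its `(L^je_λ, e_ν)` double differences `≤ g₂` (the Hölder input of (3.32));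
`sup ‖W‖ ≤ ω` with the analogous `g^W_λ, g^W_ν, g₂^W`; margin `b + L^jg_λ + L^jg_ν + L^jg₂ + 3ρ ≤ b₁`.  CONCLUSION, with `M = 2L^jb₁`:
`‖δB_μ(z+e_λ+e_ν) − δB_μ(z+e_λ) − δB_μ(z+e_ν) + δB_μ(z)‖ ≤ (Mω/ρ)(L^jg₂/ρ + L^jg_λ·L^jg_ν/ρ²) + M(L^jg^W_λ·L^jg_ν + L^jg^W_ν·L^jg_λ)/ρ²
+ M·L^jg₂^W/ρ` — `B12Ineq418DeltaB.ineq418_deltaB_invariant` with the chart (`B7LocalityGeneral.logCovIter_eq_chart`), analyticity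
(`analyticOnNhd_logCovIter_ins`) and size (`norm_logCovIter_ins_le`) inputs DISCHARGED.
[cite: Balaban1987RG1, (4.18) p.285, (4.6) p.282; Balaban1985Averaging, Prop. 4 (131) p.38, (52) p.26, p.24 (after (43))] -/
theorem ineq418_deltaB_regular_of_invariant (L : ℕ) (hL : 2 ≤ L) {G : Subgroup 𝔸ˣ} (hG : AvgClosed d L G)
    (k : ℕ) (U₀ : B7Prop1Explicit.Site d → Fin d → 𝔸ˣ) (hU₀ : ∀ x κ, U₀ x κ ∈ G) {α₀ : ℝ} (hα : 0 < α₀)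
    (hα3 : C0 d * α₀ ≤ 1 / 3) (hα4 : 4 * α₀ ≤ c2' d L) (h52 : pdev U₀ < α₀ * (((L : ℝ) ^ k)⁻¹) ^ 2)
    (F W : B7Prop1Explicit.Site d → Fin d → 𝔸) {j : ℕ} (hj : j ≤ k) (lam nu : Fin d)
    (hUL : shiftCfg (((L : ℤ) ^ j) • e lam) U₀ = U₀) (hUN : shiftCfg (((L : ℤ) ^ j) • e nu) U₀ = U₀)
    (z : B7Prop1Explicit.Site d) (μ : Fin d) {b b₁ ω gL gN g₂ gWL gWN g₂W ρ : ℝ}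
    (hsmall : Real.exp (4 * (800 * ((d : ℝ) + 1) ^ 2 * ((d : ℝ) + 4)) * α₀)
      * (1 + 8 * (131072 * ((d : ℝ) + 1) ^ 2) * ((L : ℝ) ^ k * b₁)) ≤ 2)
    (hc₃ : 2 * ((L : ℝ) ^ k * b₁) ≤ c3 d L)
    (hb : 0 ≤ b) (hF : ∀ x κ, ‖F x κ‖ ≤ b)
    (hgL0 : 0 ≤ gL) (hgL : ∀ x κ, ‖F (x + e lam) κ - F x κ‖ ≤ gL)
    (hgN0 : 0 ≤ gN) (hgN : ∀ x κ, ‖F (x + e nu) κ - F x κ‖ ≤ gN)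
    (hg₂0 : 0 ≤ g₂) (hG2 : ∀ y κ, ‖(F (y + ((L : ℤ) ^ j) • e lam + e nu) κ - F (y + ((L : ℤ) ^ j) • e lam) κ)
      - (F (y + e nu) κ - F y κ)‖ ≤ g₂)
    (hω : 0 ≤ ω) (hW : ∀ x κ, ‖W x κ‖ ≤ ω)
    (hgWL0 : 0 ≤ gWL) (hgWL : ∀ x κ, ‖W (x + e lam) κ - W x κ‖ ≤ gWL)
    (hgWN0 : 0 ≤ gWN) (hgWN : ∀ x κ, ‖W (x + e nu) κ - W x κ‖ ≤ gWN)
    (hg₂W0 : 0 ≤ g₂W) (hGW : ∀ y κ, ‖(W (y + ((L : ℤ) ^ j) • e lam + e nu) κ - W (y + ((L : ℤ) ^ j) • e lam) κ)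
      - (W (y + e nu) κ - W y κ)‖ ≤ g₂W)
    (hρ : 0 < ρ) (hroom : b + (L : ℝ) ^ j * gL + (L : ℝ) ^ j * gN + (L : ℝ) ^ j * g₂ + 3 * ρ ≤ b₁) :
    ‖dQ L U₀ F W j (z + e lam + e nu) μ - dQ L U₀ F W j (z + e lam) μ - dQ L U₀ F W j (z + e nu) μ + dQ L U₀ F W j z μ‖
      ≤ 2 * ((L : ℝ) ^ j * b₁) * ω / ρ * ((L : ℝ) ^ j * g₂ / ρ + ((L : ℝ) ^ j * gL) * ((L : ℝ) ^ j * gN) / ρ ^ 2)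
        + 2 * ((L : ℝ) ^ j * b₁) * (((L : ℝ) ^ j * gWL) * ((L : ℝ) ^ j * gN) + ((L : ℝ) ^ j * gWN) * ((L : ℝ) ^ j * gL)) / ρ ^ 2
        + 2 * ((L : ℝ) ^ j * b₁) * ((L : ℝ) ^ j * g₂W) / ρ := by
  have hL1 : 1 ≤ L := le_trans (by norm_num) hL
  have hb₁ : b ≤ b₁ := by
    have h1 : 0 ≤ (L : ℝ) ^ j * gL := by positivity
    have h2 : 0 ≤ (L : ℝ) ^ j * gN := by positivity
    have h3 : 0 ≤ (L : ℝ) ^ j * g₂ := by positivity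
    linarith
  have hb₁0 : 0 ≤ b₁ := le_trans hb hb₁
  -- the three inputs at the background `U₀ = t_0U₀` itself
  have hφ : AnalyticOnNhd ℂ (fun q : boxBonds L j z μ → 𝔸 => logCovIter L U₀ (insCfg (boxBonds L j z μ) q) j z μ)
      (ball 0 b₁) := by
    have h := analyticOnNhd_logCovIter_ins (boxBonds L j z μ) L hL hG k U₀ hU₀ hα hα3 hα4 h52 hsmall hc₃ 0 hj z μ
    simpa only [B12Ineq417Flat.shiftCfg_zero] using h
  have hM : ∀ q ∈ ball (0 : boxBonds L j z μ → 𝔸) b₁,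
      ‖logCovIter L U₀ (insCfg (boxBonds L j z μ) q) j z μ‖ ≤ 2 * ((L : ℝ) ^ j * b₁) := by
    have h := norm_logCovIter_ins_le (boxBonds L j z μ) L hL hG k U₀ hU₀ hα hα3 hα4 h52 hb₁0 hsmall hc₃ 0 hj z μ
    simpa only [B12Ineq417Flat.shiftCfg_zero] using h
  exact B12Ineq418DeltaB.ineq418_deltaB_invariant L U₀ F W j lam nu z μ
    (fun q : boxBonds L j z μ → 𝔸 => logCovIter L U₀ (insCfg (boxBonds L j z μ) q) j z μ)
    (fun G' => B7LocalityGeneral.logCovIter_eq_chart L hL1 U₀ G' j z μ) hUL hUN hφ (by positivity) hM hb hF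
    hgL0 hgL hgN0 hgN hg₂0 hG2 hω hW hgWL0 hgWL hgWN0 hgWN hg₂W0 hGW hρ hroom

end Ineq418

end Literature.MathematicalPhysics.QuantumFieldTheory.Balaban1983to89.B12Ineq417Regular

end
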